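import Mathlib.GroupTheory.Perm.Fin
import Mathlib.GroupTheory.GroupAction.Defs
import Mathlib.Tactic.Group
import Mathlib.Tactic.FinCases
import Literature.Topology.FourManifolds.PlanarShadowWalk
import HarnessLib

/-!
# `PlanarAcyclicBisectionRigidity` — negative-side support: the BALL target of the `k = 4` shadow walk is unreachable for the `s`-twin word of length 18

Support lemma for the crux
`Summit.SmoothPoincare4.SmoothPoincare4.Theses.ConvexBisection.PlanarAcyclicBisectionRigidity`
(stmt-SmoothPoincare4-15086), from the standing disprover's work file
`Cruxes/PlanarAcyclicBisectionRigidity/Disproof.lean` (§L, "Line `Sketch`"), over the LANDED shadow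
vocabulary `Literature.Topology.FourManifolds.PlanarShadow` (file `PlanarShadowWalk.lean`).
Pure theorems (no definitions, no notation): the instance data are written out as terms.

The picked line's lever `stub_shadowWalkK4` (`Cruxes/…/Lines/Sketch.lean`) asks that every start
state `[a₁, a₂, b₂⁻¹, b₁⁻¹]` of the `F₂` shadow reach, by signed Hurwitz moves, a BALL state (two
adjacent letters `(c x c⁻¹, c y c⁻¹)`) OR an honest DOUBLE state.  This file refutes the natural
strengthening "ball states alone suffice" (the predecessor line's target `T1`; the behaviour of the
reflection-twin family `x (yX)^m y (xY)^m`, K4AxesEvidence §4) and shows on the same instance that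
the double target is met:

* `reachable_forall_mem` — THE INVARIANT: membership of all letters in a subgroup is invariant
  under the moves (new letters are words in the old ones), hence under `Reachable`;
  `eq_top_of_isBallState` — the letters of a ball state generate `F₂`;
* `not_isBallState_of_forall_fix` — a ball state `(…, c x c⁻¹, c y c⁻¹, …)` whose letters all fix a
  point `p` under a permutation representation `x ↦ f 0`, `y ↦ f 1` in which `f 0`, `f 1` have no
  common fixed point is absurd (`x`, `y` would both fix the point `f(c)⁻¹ p`);
* `sWord_never_ball` — for the two-axis word `w = x y x Y X Y x y x y X Y X y x y X Y`
  (the `s`-only twin of cyclic length 18, K4AxesEvidence §3; `X = x⁻¹`, `Y = y⁻¹`) and its two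
  Hurwitz classes `P = (x, k y k⁻¹)` (`k = y x Y X Y x y x`), `Q = (c x c⁻¹, d y d⁻¹)`
  (`c = x y x Y X Y`, `d = y x`), NO state reachable from `startState P Q` is a ball state — under
  `x ↦ (1 2)`, `y ↦ (0 2)` in `S₃` the four start letters fix `0` (they generate an infinite-index
  subgroup of `F₂`: Stallings graph with three vertices, of which this is the completed monodromy);
* `not_forall_reachable_isBallState` — hence the ball-only form of the lever is FALSE;
* `sWord_reachable_isDoubleState` — while an honest double IS reached from the same start state in
  four moves (`σ₁⁻¹ σ₂ σ₂ σ₁`), as the lever predicts (`P`, `Q` do lie in `XYPairs w`: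
  `sWord_mem_XYPairs`).

So any proof of `stub_shadowWalkK4` must use the double target; the disprover's work file records
why the double target is in fact ALWAYS reachable (innermost-arc descent, Disproof §L).
-/

-- The namespace is prescribed by the crux protocol (`Summit.<P>.<Sub>.Theorems.<Crux>.Negative`
-- with `P = Sub = SmoothPoincare4`), hence the duplicated component.
set_option linter.dupNamespace false

namespace Summit.SmoothPoincare4.SmoothPoincare4.Theorems.PlanarAcyclicBisectionRigidity.Negative

open Literature.Topology.FourManifolds.PlanarShadow

/-! ## §1 The subgroup invariant of the shadow walk -/

/-- **A move preserves "all letters lie in the subgroup `S`"**, in both directions: the new letters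
`a b a⁻¹`, `a`, resp. `b`, `b⁻¹ a b`, are words in the old ones and conversely. [folklore] -/
theorem move_forall_mem_iff {S : Subgroup F₂} {s t : List F₂} (h : Move s t) :
    (∀ g ∈ s, g ∈ S) ↔ (∀ g ∈ t, g ∈ S) := by
  cases h with
  | hurwitz pre post a b =>
      simp only [List.forall_mem_append, List.forall_mem_cons]
      constructor
      · rintro ⟨hpre, ha, hb, hpost⟩
        exact ⟨hpre, S.mul_mem (S.mul_mem ha hb) (S.inv_mem ha), ha, hpost⟩
      · rintro ⟨hpre, hab, ha, hpost⟩
        refine ⟨hpre, ha, ?_, hpost⟩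
        have key : b = a⁻¹ * (a * b * a⁻¹) * a := by group
        rw [key]
        exact S.mul_mem (S.mul_mem (S.inv_mem ha) hab) ha
  | hurwitzInv pre post a b =>
      simp only [List.forall_mem_append, List.forall_mem_cons]
      constructor
      · rintro ⟨hpre, ha, hb, hpost⟩
        exact ⟨hpre, hb, S.mul_mem (S.mul_mem (S.inv_mem hb) ha) hb, hpost⟩
      · rintro ⟨hpre, hb, hba, hpost⟩
        refine ⟨hpre, ?_, hb, hpost⟩
        have key : a = b * (b⁻¹ * a * b) * b⁻¹ := by group
        rw [key]
        exact S.mul_mem (S.mul_mem hb hba) (S.inv_mem hb)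

/-- **THE INVARIANT of the shadow walk**: if every letter of `s` lies in a subgroup `S`, so does
every letter of every state reachable from `s` (the subgroup generated by the letters is an orbit
invariant). [folklore] -/
theorem reachable_forall_mem {S : Subgroup F₂} {s t : List F₂} (h : Reachable s t)
    (hs : ∀ g ∈ s, g ∈ S) : ∀ g ∈ t, g ∈ S := by
  induction h with
  | refl => exact hs
  | tail _ hst ih =>
      rcases hst with hm | hm
      · exact (move_forall_mem_iff hm).1 ih
      · exact (move_forall_mem_iff hm).2 ih

/-- **A ball state generates everything**: if all letters of a ball state lie in `S` then `S = ⊤`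
(`c x c⁻¹` and `c y c⁻¹` generate `c F₂ c⁻¹ = F₂`).  So "the letters generate a proper subgroup" is
an obstruction to EVER reaching a ball state. [folklore] -/
theorem eq_top_of_isBallState {S : Subgroup F₂} {s : List F₂} (hb : IsBallState s)
    (hs : ∀ g ∈ s, g ∈ S) : S = ⊤ := by
  obtain ⟨c, pre, post, rfl⟩ := hb
  have hx : c * gx * c⁻¹ ∈ S := hs _ (by simp)
  have hy : c * gy * c⁻¹ ∈ S := hs _ (by simp)
  -- the conjugate subgroup `c⁻¹ S c` contains `x` and `y`, hence everything
  have key : ∀ g : F₂, c * g * c⁻¹ ∈ S := by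
    intro g
    induction g using FreeGroup.induction_on with
    | C1 => simp
    | of i =>
        fin_cases i
        · exact hx
        · exact hy
    | inv_of i ih =>
        have := S.inv_mem ih
        simpa [mul_assoc] using this
    | mul g h ihg ihh =>
        have := S.mul_mem ihg ihh
        have e : c * g * c⁻¹ * (c * h * c⁻¹) = c * (g * h) * c⁻¹ := by group
        simpa [e] using this
  rw [eq_top_iff]
  intro g _
  have := key (c⁻¹ * g * c)
  have e : c * (c⁻¹ * g * c) * c⁻¹ = g := by group
  simpa [e] using this

/-! ## §2 Permutation certificates -/

/-- **A ball state cannot have all its letters fixing a point `p`** under a representation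
`x ↦ f 0`, `y ↦ f 1` of `F₂` by permutations in which `f 0` and `f 1` have no common fixed point:
from `f(c x c⁻¹) p = p` and `f(c y c⁻¹) p = p` the point `f(c)⁻¹ p` is fixed by both. [folklore] -/
theorem not_isBallState_of_forall_fix {α : Type*} (f : Fin 2 → Equiv.Perm α) (p : α)
    (hf : ∀ q : α, f 0 q = q → f 1 q = q → False) {s : List F₂}
    (hs : ∀ g ∈ s, FreeGroup.lift f g p = p) : ¬ IsBallState s := by
  rintro ⟨c, pre, post, rfl⟩
  have hx : FreeGroup.lift f (c * gx * c⁻¹) p = p := hs _ (by simp)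
  have hy : FreeGroup.lift f (c * gy * c⁻¹) p = p := hs _ (by simp)
  simp only [map_mul, map_inv, gx, gy, FreeGroup.lift_apply_of] at hx hy
  have hx' : f 0 ((FreeGroup.lift f c).symm p) = (FreeGroup.lift f c).symm p := by
    rw [Equiv.eq_symm_apply]
    simpa [Equiv.Perm.coe_mul, Equiv.Perm.coe_inv] using hx
  have hy' : f 1 ((FreeGroup.lift f c).symm p) = (FreeGroup.lift f c).symm p := by
    rw [Equiv.eq_symm_apply]
    simpa [Equiv.Perm.coe_mul, Equiv.Perm.coe_inv] using hy
  exact hf _ hx' hy'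

/-- **No state reachable from a start state whose letters fix `p` is a ball state** (the elements
fixing `p` form a subgroup, the preimage of a stabiliser). [folklore] -/
theorem not_isBallState_of_reachable_of_forall_fix {α : Type*} (f : Fin 2 → Equiv.Perm α) (p : α)
    (hf : ∀ q : α, f 0 q = q → f 1 q = q → False) {s t : List F₂}
    (hs : ∀ g ∈ s, FreeGroup.lift f g p = p) (h : Reachable s t) : ¬ IsBallState t := by
  refine not_isBallState_of_forall_fix f p hf ?_
  have hs' : ∀ g ∈ s, g ∈ (MulAction.stabilizer (Equiv.Perm α) p).comap (FreeGroup.lift f) := hs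
  exact reachable_forall_mem h hs'

/-- `(1 2)` and `(0 2)` in `S₃` have no common fixed point. [folklore] -/
theorem swap_one_two_swap_zero_two_no_common_fixed_point (q : Fin 3)
    (hx : (![Equiv.swap 1 2, Equiv.swap 0 2] : Fin 2 → Equiv.Perm (Fin 3)) 0 q = q)
    (hy : (![Equiv.swap 1 2, Equiv.swap 0 2] : Fin 2 → Equiv.Perm (Fin 3)) 1 q = q) : False := by
  revert q hx hy
  decide

/-! ## §3 The instance: the `s`-twin two-axis word of length 18

`k = y x Y X Y x y x`, `c = x y x Y X Y`, `d = y x`, `w = x k y k⁻¹`, `P = (x, k y k⁻¹)`,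
`Q = (c x c⁻¹, d y d⁻¹)`; start state `[x, k y k⁻¹, (d y d⁻¹)⁻¹, (c x c⁻¹)⁻¹]`. -/

/-- `P` and `Q` are (`x`-conjugate, `y`-conjugate) factorisations of the SAME `w = x k y k⁻¹` — the
second is the free-group identity `c x c⁻¹ · d y d⁻¹ = x k y k⁻¹`. [folklore] -/
theorem sWord_mem_XYPairs :
    ((gx, (gy * gx * gy⁻¹ * gx⁻¹ * gy⁻¹ * gx * gy * gx) * gy *
        (gy * gx * gy⁻¹ * gx⁻¹ * gy⁻¹ * gx * gy * gx)⁻¹) : F₂ × F₂) ∈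
      XYPairs (gx * ((gy * gx * gy⁻¹ * gx⁻¹ * gy⁻¹ * gx * gy * gx) * gy *
        (gy * gx * gy⁻¹ * gx⁻¹ * gy⁻¹ * gx * gy * gx)⁻¹)) ∧
    (((gx * gy * gx * gy⁻¹ * gx⁻¹ * gy⁻¹) * gx * (gx * gy * gx * gy⁻¹ * gx⁻¹ * gy⁻¹)⁻¹,
        (gy * gx) * gy * (gy * gx)⁻¹) : F₂ × F₂) ∈
      XYPairs (gx * ((gy * gx * gy⁻¹ * gx⁻¹ * gy⁻¹ * gx * gy * gx) * gy *
        (gy * gx * gy⁻¹ * gx⁻¹ * gy⁻¹ * gx * gy * gx)⁻¹)) := by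
  refine ⟨⟨⟨1, by simp⟩, ⟨_, rfl⟩, rfl⟩, ⟨⟨_, rfl⟩, ⟨_, rfl⟩, ?_⟩⟩
  simp only
  group

/-- **Every letter of the start state fixes `0` under `x ↦ (1 2)`, `y ↦ (0 2)`.** [folklore] -/
theorem sWord_startState_forall_fix :
    ∀ g ∈ startState
        ((gx, (gy * gx * gy⁻¹ * gx⁻¹ * gy⁻¹ * gx * gy * gx) * gy *
          (gy * gx * gy⁻¹ * gx⁻¹ * gy⁻¹ * gx * gy * gx)⁻¹) : F₂ × F₂)
        (((gx * gy * gx * gy⁻¹ * gx⁻¹ * gy⁻¹) * gx * (gx * gy * gx * gy⁻¹ * gx⁻¹ * gy⁻¹)⁻¹,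
          (gy * gx) * gy * (gy * gx)⁻¹) : F₂ × F₂),
      FreeGroup.lift (![Equiv.swap 1 2, Equiv.swap 0 2] : Fin 2 → Equiv.Perm (Fin 3)) g 0 = 0 := by
  intro g hg
  simp only [startState, List.mem_cons, List.not_mem_nil, or_false] at hg
  rcases hg with rfl | rfl | rfl | rfl <;>
    simp [gx, gy, map_mul, map_inv, Equiv.Perm.mul_apply] <;> decide

/-- **NO BALL, EVER**: no state reachable from the start state of `(P, Q)` is a ball state.
[folklore] -/
theorem sWord_never_ball (t : List F₂)
    (h : Reachable (startState
        ((gx, (gy * gx * gy⁻¹ * gx⁻¹ * gy⁻¹ * gx * gy * gx) * gy *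
          (gy * gx * gy⁻¹ * gx⁻¹ * gy⁻¹ * gx * gy * gx)⁻¹) : F₂ × F₂)
        (((gx * gy * gx * gy⁻¹ * gx⁻¹ * gy⁻¹) * gx * (gx * gy * gx * gy⁻¹ * gx⁻¹ * gy⁻¹)⁻¹,
          (gy * gx) * gy * (gy * gx)⁻¹) : F₂ × F₂)) t) :
    ¬ IsBallState t :=
  not_isBallState_of_reachable_of_forall_fix _ 0 swap_one_two_swap_zero_two_no_common_fixed_point
    sWord_startState_forall_fix h

/-- **The ball-only form of the lever `stub_shadowWalkK4` is FALSE.** [folklore] -/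
theorem not_forall_reachable_isBallState :
    ¬ ∀ (w : F₂) (P Q : F₂ × F₂), P ∈ XYPairs w → Q ∈ XYPairs w →
        ∃ t : List F₂, Reachable (startState P Q) t ∧ IsBallState t := by
  intro h
  obtain ⟨t, ht, hb⟩ := h _ _ _ sWord_mem_XYPairs.1 sWord_mem_XYPairs.2
  exact sWord_never_ball t ht hb

/-! ## §4 … while the honest double IS reached (four moves) -/

/-- **The same start state reaches the honest double `[x, g, g⁻¹, x⁻¹]`, `g = d y d⁻¹`, in four
moves** (`σ₁⁻¹` at position 1, `σ₂` twice at position 2, `σ₁` at position 1; found by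
length-greedy search, verified here symbolically: each letter identity is a free-group identity).
[folklore] -/
theorem sWord_reachable_double :
    Reachable (startState
        ((gx, (gy * gx * gy⁻¹ * gx⁻¹ * gy⁻¹ * gx * gy * gx) * gy *
          (gy * gx * gy⁻¹ * gx⁻¹ * gy⁻¹ * gx * gy * gx)⁻¹) : F₂ × F₂)
        (((gx * gy * gx * gy⁻¹ * gx⁻¹ * gy⁻¹) * gx * (gx * gy * gx * gy⁻¹ * gx⁻¹ * gy⁻¹)⁻¹,
          (gy * gx) * gy * (gy * gx)⁻¹) : F₂ × F₂))
      [gx, (gy * gx) * gy * (gy * gx)⁻¹, ((gy * gx) * gy * (gy * gx)⁻¹)⁻¹, gx⁻¹] := by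
  -- the four letters of the start state
  set k : F₂ := gy * gx * gy⁻¹ * gx⁻¹ * gy⁻¹ * gx * gy * gx with hk
  set c : F₂ := gx * gy * gx * gy⁻¹ * gx⁻¹ * gy⁻¹ with hc
  set d : F₂ := gy * gx with hd
  set t₂ : F₂ := k * gy * k⁻¹ with ht₂
  set t₃ : F₂ := (d * gy * d⁻¹)⁻¹ with ht₃
  set t₄ : F₂ := (c * gx * c⁻¹)⁻¹ with ht₄
  have h0 : startState ((gx, t₂) : F₂ × F₂) ((c * gx * c⁻¹, d * gy * d⁻¹) : F₂ × F₂) =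
      [gx, t₂, t₃, t₄] := rfl
  -- move 1: inverse Hurwitz move at position 1
  have m1 : Move [gx, t₂, t₃, t₄] [gx, t₃, t₃⁻¹ * t₂ * t₃, t₄] :=
    Move.hurwitzInv [gx] [t₄] t₂ t₃
  set u : F₂ := t₃⁻¹ * t₂ * t₃ with hu
  -- move 2: Hurwitz move at position 2
  have m2 : Move [gx, t₃, u, t₄] [gx, t₃, u * t₄ * u⁻¹, u] :=
    Move.hurwitz [gx, t₃] [] u t₄
  set v : F₂ := u * t₄ * u⁻¹ with hv
  -- move 3: Hurwitz move at position 2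
  have m3 : Move [gx, t₃, v, u] [gx, t₃, v * u * v⁻¹, v] :=
    Move.hurwitz [gx, t₃] [] v u
  set m : F₂ := v * u * v⁻¹ with hm
  -- move 4: Hurwitz move at position 1
  have m4 : Move [gx, t₃, m, v] [gx, t₃ * m * t₃⁻¹, t₃, v] :=
    Move.hurwitz [gx] [v] t₃ m
  have hfinal : [gx, t₃ * m * t₃⁻¹, t₃, v] = [gx, d * gy * d⁻¹, (d * gy * d⁻¹)⁻¹, gx⁻¹] := by
    simp only [hm, hv, hu, ht₂, ht₃, ht₄, hk, hc, hd, List.cons.injEq, and_true]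
    refine ⟨trivial, ?_, ?_, ?_⟩ <;> group
  rw [h0, ← hfinal]
  exact (((m1.reachable).trans m2.reachable).trans m3.reachable).trans m4.reachable

/-- **The lever's disjunction holds on this instance through the DOUBLE target** (and only
through it, `sWord_never_ball`). [folklore] -/
theorem sWord_reachable_isDoubleState :
    ∃ t : List F₂, Reachable (startState
        ((gx, (gy * gx * gy⁻¹ * gx⁻¹ * gy⁻¹ * gx * gy * gx) * gy *
          (gy * gx * gy⁻¹ * gx⁻¹ * gy⁻¹ * gx * gy * gx)⁻¹) : F₂ × F₂)
        (((gx * gy * gx * gy⁻¹ * gx⁻¹ * gy⁻¹) * gx * (gx * gy * gx * gy⁻¹ * gx⁻¹ * gy⁻¹)⁻¹,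
          (gy * gx) * gy * (gy * gx)⁻¹) : F₂ × F₂)) t ∧ IsDoubleState t :=
  ⟨_, sWord_reachable_double, gx, (gy * gx) * gy * (gy * gx)⁻¹, ⟨1, Or.inl (by simp)⟩,
    ⟨gy * gx, Or.inr rfl⟩, rfl⟩

end Summit.SmoothPoincare4.SmoothPoincare4.Theorems.PlanarAcyclicBisectionRigidity.Negative
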